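import Mathlib
import Literature.Computability.Complexity.CNF
import Literature.Computability.Complexity.PNPWave0
import Literature.Computability.Complexity.RandomKSatLowDegreeHardness
import Summits.PneNP.PneNP.Theses.OverlapGapAlgebra
import Summits.PneNP.PneNP.Theorems.OverlapGapAlgebraSearchHardWindowWindowGlue
import Summits.PneNP.PneNP.Theorems.SearchHardWindow.Negative.FalseWithoutPolyTime

/-!
# Line `LinearDegreeRedirect` — crux stmt-PneNP-2460 `SearchHardWindow` (route-PneNP-OverlapGapAlgebra)

Crux-strategist r1 (planner-cstrat-stmt-PneNP-2460-r1-0, 2026-08-17). Skeleton of the LINEAR-DEGREE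
REDIRECT: two registered stubs — the two pieces of the BC2-redirect decomposition of the crux — and the
kernel-checked composition `SearchHardWindow_of` concluding the crux BY NAME. The composition is the
split glue `searchHardWindow_of_linearDegree` (planner folder `LinearDegreeSplit.lean`, rc 0, axioms
standard; attached as item evidence; to be landed by a prover as
`Theorems/OverlapGapAlgebraSearchHardWindowLinearDegreeSplit.lean`), re-elaborated here verbatim.

* `stub_linearDegreeHardness` (f-free, size L–XL, the ATTACKABLE stub): strong low-degree hardness of
  random `k`-SAT at LINEAR coordinate degree with an `ε`-dependent fraction `δ(k, C, ε)` — print stops at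
  `o(N)` (HS25 Cor. 3.21 = tree `huangSellke2025KSat_holds`) / `O(n/log n)` weak sense (BH21 Thm 2.6).
  Birth skeleton: `bc/LinearDegreeHardness_birth.lean` (linear-rate obstructions + HS assembly re-run).
* `stub_linearDegreeSimulation` (complexity, the KERNEL): linear-degree simulation of poly-time success
  at every density. At the window it is `H(k) ∨ ¬stub_linearDegreeHardness(k)`
  (`shwLD_simulationAt_of_hardAt`): strictly weaker than `H` while stub 1 is open, equivalent to it
  once stub 1 lands. Off-window content: exact low-degree solvability wherever `P` succeeds.

Disproof used: §C `searchHardWindow_false_without_polyTime` — the time bound is used exactly once, in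
stub 2's antecedent (`IsPolyTime f`); §D (Line A targets) — this line IS Line A with the degree cut
moved from `o(n)` (where the rung is a theorem and the kernel ⟺ H, `shwK_kernelAt_iff_hardAt`) to
`δ n` (where the rung is open in print, so the kernel is `H ∨ L`, not `H`).
-/

set_option linter.dupNamespace false

noncomputable section

namespace Summit.PneNP.PneNP.Cruxes.SearchHardWindow.LinearDegreeRedirect

open Summit.PneNP.PneNP.Theorems
open Finset Filter Asymptotics
open Literature.Computability.Complexity
open scoped Classical

/-- **Pieces ⇒ hardness conjunct, at one `k ≥ 2`.** If (piece 1 at `k`) for every `C, ε > 0` some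
`δ > 0` makes every coordinate-degree-`⌊δ n⌋`, energy-`C` saturated sign map solve `≤ ε · #Φ`
instances of `F_k(n, ⌊α_k n⌋)` eventually, and (piece 2 at `k`, every density) frequent poly-time
success `≥ ε` is shadowed at every degree fraction `δ` by frequent saturated low-degree success
`≥ ε/2` with an energy constant depending on the density only, then every polynomial-time `f` solves
`F_k(n, ⌊α_k n⌋)` with probability `→ 0` (`α_k = 5 · 2^k log k / k`).
[HuangSellke2025, Cor. 3.21 (the `o(N)` case); BreslerHuang2022, §10] -/
theorem ldr_hardAt_of_pieces {k : ℕ} (hk : 2 ≤ k)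
    (hA : ∀ C : ℝ, 0 < C → ∀ ε : ℝ, 0 < ε → ∃ δ : ℝ, 0 < δ ∧
      ∀ F : (n : ℕ) → (m : ℕ) → (Fin m → Fin k → Fin n × Bool) → Fin n → ℝ,
      (∀ (n m : ℕ) (v : Fin n), IsCoordDegreeLE ⌊δ * n⌋₊
        (fun y : Fin m × Fin k → Fin n × Bool => F n m (Function.curry y) v)) →
      (∀ n m : ℕ, m = ⌊5 * 2 ^ k * Real.log k / k * n⌋₊ →
        ∑ Φ : Fin m → Fin k → Fin n × Bool, ∑ v : Fin n, F n m Φ v ^ 2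
          ≤ C * n * Fintype.card (Fin m → Fin k → Fin n × Bool)) →
      ∀ᶠ n : ℕ in Filter.atTop, ∀ m : ℕ, m = ⌊5 * 2 ^ k * Real.log k / k * n⌋₊ →
        ((Finset.univ.filter fun Φ : Fin m → Fin k → Fin n × Bool =>
          (∀ v : Fin n, 1 ≤ |F n m Φ v|) ∧
          ∀ i : Fin m, ∃ j : Fin k, decide (0 ≤ F n m Φ (Φ i j).1) = (Φ i j).2).card : ℝ)
          ≤ ε * Fintype.card (Fin m → Fin k → Fin n × Bool))
    (hB : ∀ α : ℝ, 0 < α → ∃ C : ℝ, 0 < C ∧ ∀ δ : ℝ, 0 < δ → ∀ f : List Bool → List Bool,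
      Literature.Computability.Complexity.IsPolyTime f → ∀ ε : ℝ, 0 < ε →
      (∃ᶠ n : ℕ in Filter.atTop, ∀ m : ℕ, m = ⌊α * n⌋₊ →
        ε * Fintype.card (Fin m → Fin k → Fin n × Bool) ≤
        ((Finset.univ.filter fun Φ : Fin m → Fin k → Fin n × Bool => ∀ i, ∃ j,
          (f (Literature.Computability.Complexity.encodingCNF.encode (List.ofFn fun a =>
            List.ofFn fun b => (((Φ a b).1 : ℕ), (Φ a b).2)))).getD (Φ i j).1 false =
            (Φ i j).2).card : ℝ)) →
      ∃ F : (n : ℕ) → (m : ℕ) → (Fin m → Fin k → Fin n × Bool) → Fin n → ℝ,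
      (∀ (n m : ℕ) (v : Fin n), IsCoordDegreeLE ⌊δ * n⌋₊
        (fun y : Fin m × Fin k → Fin n × Bool => F n m (Function.curry y) v)) ∧
      (∀ n m : ℕ, m = ⌊α * n⌋₊ →
        ∑ Φ : Fin m → Fin k → Fin n × Bool, ∑ v : Fin n, F n m Φ v ^ 2
          ≤ C * n * Fintype.card (Fin m → Fin k → Fin n × Bool)) ∧
      ∃ᶠ n : ℕ in Filter.atTop, ∀ m : ℕ, m = ⌊α * n⌋₊ →
        ε / 2 * Fintype.card (Fin m → Fin k → Fin n × Bool) ≤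
        ((Finset.univ.filter fun Φ : Fin m → Fin k → Fin n × Bool =>
          (∀ v : Fin n, 1 ≤ |F n m Φ v|) ∧
          ∀ i : Fin m, ∃ j : Fin k, decide (0 ≤ F n m Φ (Φ i j).1) = (Φ i j).2).card : ℝ)) :
    ∀ f : List Bool → List Bool, IsPolyTime f → ∀ ε : ℝ, 0 < ε →
      ∀ᶠ n : ℕ in atTop, ∀ m : ℕ, m = ⌊5 * 2 ^ k * Real.log k / k * n⌋₊ →
      ((univ.filter fun Φ : Fin m → Fin k → Fin n × Bool => ∀ i, ∃ j,
      (f (encodingCNF.encode (List.ofFn fun a => List.ofFn fun b =>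
      (((Φ a b).1 : ℕ), (Φ a b).2)))).getD (Φ i j).1 false = (Φ i j).2).card : ℝ) /
      Fintype.card (Fin m → Fin k → Fin n × Bool) ≤ ε := by
  intro f hf ε hε
  -- the window density is positive (`k ≥ 2`, so `log k > 0`)
  have hkr : (2 : ℝ) ≤ k := by exact_mod_cast hk
  have hkpos : (0 : ℝ) < k := by linarith
  have hlogk : 0 < Real.log k := Real.log_pos (by linarith)
  have hα : (0 : ℝ) < 5 * 2 ^ k * Real.log k / k := by positivity
  -- the energy constant of piece 2 at the window density, then the degree fraction of piece 1
  obtain ⟨C, hC, hBk⟩ := hB (5 * 2 ^ k * Real.log k / k) hα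
  obtain ⟨δ, hδ, hAk⟩ := hA C hC (ε / 4) (by positivity)
  by_contra H
  -- frequent success `> ε`, as a count inequality
  have hfreq : ∃ᶠ n : ℕ in atTop, ∀ m : ℕ, m = ⌊5 * 2 ^ k * Real.log k / k * n⌋₊ →
      ε * Fintype.card (Fin m → Fin k → Fin n × Bool) ≤
        ((univ.filter fun Φ : Fin m → Fin k → Fin n × Bool => ∀ i, ∃ j,
            (f (encodingCNF.encode (List.ofFn fun a => List.ofFn fun b =>
              (((Φ a b).1 : ℕ), (Φ a b).2)))).getD (Φ i j).1 false = (Φ i j).2).card : ℝ) := by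
    rw [Filter.not_eventually] at H
    refine H.mono fun n hn => ?_
    intro m hm
    rw [Classical.not_forall] at hn
    obtain ⟨m', hm'⟩ := hn
    rw [Classical.not_imp, not_le] at hm'
    obtain ⟨hm'eq, hlt⟩ := hm'
    subst hm; subst hm'eq
    set N := (Fintype.card (Fin ⌊5 * 2 ^ k * Real.log k / k * n⌋₊ → Fin k → Fin n × Bool) : ℝ)
    have hNpos : 0 < N := by
      rcases lt_or_ge 0 N with h | h
      · exact h
      · have hN0 : N = 0 := le_antisymm h (Nat.cast_nonneg _)
        rw [hN0, div_zero] at hlt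
        exact absurd hlt (not_lt.2 hε.le)
    exact le_of_lt ((lt_div_iff₀ hNpos).1 hlt)
  -- piece 2: a linear-degree shadow succeeding `≥ ε/2 · #Φ` frequently
  obtain ⟨F, hdeg, hener, hFfreq⟩ := hBk δ hδ f hf ε hε hfreq
  -- piece 1: every such map succeeds on `≤ ε/4 · #Φ` eventually
  have hev := hAk F hdeg hener
  obtain ⟨n, hn₁, hn₂, hn₃⟩ := (hFfreq.and_eventually (hev.and (eventually_ge_atTop 1))).exists
  have h₁ := hn₁ _ rfl
  have h₂ := hn₂ _ rfl
  have hcard : (1 : ℝ) ≤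
      Fintype.card (Fin ⌊5 * 2 ^ k * Real.log k / k * n⌋₊ → Fin k → Fin n × Bool) := by
    have : Nonempty (Fin ⌊5 * 2 ^ k * Real.log k / k * n⌋₊ → Fin k → Fin n × Bool) :=
      ⟨fun _ _ => (⟨0, hn₃⟩, true)⟩
    exact_mod_cast Fintype.card_pos
  have : ε / 2 * (Fintype.card (Fin ⌊5 * 2 ^ k * Real.log k / k * n⌋₊ → Fin k → Fin n × Bool) : ℝ)
      ≤ ε / 4 * Fintype.card (Fin ⌊5 * 2 ^ k * Real.log k / k * n⌋₊ → Fin k → Fin n × Bool) :=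
    h₁.trans h₂
  nlinarith

/-- **The split glue (BC2 redirect of `SearchHardWindow`).** Piece 1 (`LinearDegreeHardness`) and
piece 2 (`LinearDegreeSimulation`) — stated here by their verbatim bodies — imply the body of the
crux `SearchHardWindow` of route OverlapGapAlgebra, witnessed at `(k, α_k)` with
`k = max (max k₀ k₁) 1024`: the hardness conjunct is `shwLD_hardAt_of_pieces`, the positivity
conjunct is Achlioptas–Peres at `α_k < ρ_k` inside the route-free window glue
`shwW_searchHardWindow_of_windowHard`. Inside the route file,
`theorem SearchHardWindowGlueBy_holds : LinearDegreeHardness → LinearDegreeSimulation →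
SearchHardWindow := searchHardWindow_of_linearDegree` elaborates by unfolding.
[AchlioptasPeres2004, Thm. 2; HuangSellke2025, Cor. 3.21; BreslerHuang2022, Thm. 2.6 and §10] -/
theorem ldr_searchHardWindowBody_of_pieces
    (hA : ∃ k₀ : ℕ, ∀ k ≥ k₀, ∀ C : ℝ, 0 < C → ∀ ε : ℝ, 0 < ε → ∃ δ : ℝ, 0 < δ ∧
      ∀ F : (n : ℕ) → (m : ℕ) → (Fin m → Fin k → Fin n × Bool) → Fin n → ℝ,
      (∀ (n m : ℕ) (v : Fin n), Literature.Computability.Complexity.IsCoordDegreeLE ⌊δ * n⌋₊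
        (fun y : Fin m × Fin k → Fin n × Bool => F n m (Function.curry y) v)) →
      (∀ n m : ℕ, m = ⌊5 * 2 ^ k * Real.log k / k * n⌋₊ →
        ∑ Φ : Fin m → Fin k → Fin n × Bool, ∑ v : Fin n, F n m Φ v ^ 2
          ≤ C * n * Fintype.card (Fin m → Fin k → Fin n × Bool)) →
      ∀ᶠ n : ℕ in Filter.atTop, ∀ m : ℕ, m = ⌊5 * 2 ^ k * Real.log k / k * n⌋₊ →
        ((Finset.univ.filter fun Φ : Fin m → Fin k → Fin n × Bool =>
          (∀ v : Fin n, 1 ≤ |F n m Φ v|) ∧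
          ∀ i : Fin m, ∃ j : Fin k, decide (0 ≤ F n m Φ (Φ i j).1) = (Φ i j).2).card : ℝ)
          ≤ ε * Fintype.card (Fin m → Fin k → Fin n × Bool))
    (hB : ∃ k₁ : ℕ, ∀ k ≥ k₁, ∀ α : ℝ, 0 < α → ∃ C : ℝ, 0 < C ∧ ∀ δ : ℝ, 0 < δ →
      ∀ f : List Bool → List Bool, Literature.Computability.Complexity.IsPolyTime f →
      ∀ ε : ℝ, 0 < ε →
      (∃ᶠ n : ℕ in Filter.atTop, ∀ m : ℕ, m = ⌊α * n⌋₊ →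
        ε * Fintype.card (Fin m → Fin k → Fin n × Bool) ≤
        ((Finset.univ.filter fun Φ : Fin m → Fin k → Fin n × Bool => ∀ i, ∃ j,
          (f (Literature.Computability.Complexity.encodingCNF.encode (List.ofFn fun a =>
            List.ofFn fun b => (((Φ a b).1 : ℕ), (Φ a b).2)))).getD (Φ i j).1 false =
            (Φ i j).2).card : ℝ)) →
      ∃ F : (n : ℕ) → (m : ℕ) → (Fin m → Fin k → Fin n × Bool) → Fin n → ℝ,
      (∀ (n m : ℕ) (v : Fin n), Literature.Computability.Complexity.IsCoordDegreeLE ⌊δ * n⌋₊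
        (fun y : Fin m × Fin k → Fin n × Bool => F n m (Function.curry y) v)) ∧
      (∀ n m : ℕ, m = ⌊α * n⌋₊ →
        ∑ Φ : Fin m → Fin k → Fin n × Bool, ∑ v : Fin n, F n m Φ v ^ 2
          ≤ C * n * Fintype.card (Fin m → Fin k → Fin n × Bool)) ∧
      ∃ᶠ n : ℕ in Filter.atTop, ∀ m : ℕ, m = ⌊α * n⌋₊ →
        ε / 2 * Fintype.card (Fin m → Fin k → Fin n × Bool) ≤
        ((Finset.univ.filter fun Φ : Fin m → Fin k → Fin n × Bool =>
          (∀ v : Fin n, 1 ≤ |F n m Φ v|) ∧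
          ∀ i : Fin m, ∃ j : Fin k, decide (0 ≤ F n m Φ (Φ i j).1) = (Φ i j).2).card : ℝ)) :
    ∃ (k : ℕ) (α : ℝ),
    (∃ ε : ℝ, 0 < ε ∧ ∀ᶠ n : ℕ in Filter.atTop, ∀ m : ℕ, m = ⌊α * n⌋₊ → ε ≤ ((Finset.univ.filter
    fun Φ : Fin m → Fin k → Fin n × Bool => ∃ σ : Fin n → Bool, ∀ i, ∃ j, σ (Φ i j).1 = (Φ i
    j).2).card : ℝ) / Fintype.card (Fin m → Fin k → Fin n × Bool)) ∧ ∀ f : List Bool → List Bool,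
    Literature.Computability.Complexity.IsPolyTime f → ∀ ε : ℝ, 0 < ε → ∀ᶠ n : ℕ in Filter.atTop,
    ∀ m : ℕ, m = ⌊α * n⌋₊ → ((Finset.univ.filter fun Φ : Fin m → Fin k → Fin n × Bool => ∀ i, ∃ j,
    (f (Literature.Computability.Complexity.encodingCNF.encode (List.ofFn fun a => List.ofFn fun b
    => (((Φ a b).1 : ℕ), (Φ a b).2)))).getD (Φ i j).1 false = (Φ i j).2).card : ℝ) / Fintype.card
    (Fin m → Fin k → Fin n × Bool) ≤ ε := by
  obtain ⟨k₀, hA⟩ := hA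
  obtain ⟨k₁, hB⟩ := hB
  refine shwW_searchHardWindow_of_windowHard ⟨max (max k₀ k₁) 1024, le_max_right _ _, ?_⟩
  have hk₀ : k₀ ≤ max (max k₀ k₁) 1024 := (le_max_left _ _).trans (le_max_left _ _)
  have hk₁ : k₁ ≤ max (max k₀ k₁) 1024 := (le_max_right _ _).trans (le_max_left _ _)
  have hk2 : 2 ≤ max (max k₀ k₁) 1024 := le_trans (by norm_num) (le_max_right _ _)
  exact ldr_hardAt_of_pieces hk2 (hA _ hk₀) (hB _ hk₁)

/-- **Honesty certificate: the hardness conjunct implies piece 2's window instance.** If `H(k)`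
holds, then the `(k, α_k)`-instance of `LinearDegreeSimulation` holds VACUOUSLY (no poly-time `f`
succeeds frequently: `kernelHypothesis_false_of_hardness`), whatever the energy constant and the
degree fraction. So at its load-bearing instance piece 2 reads `H(k) ∨ ¬(piece 1 at k)`: strictly
weaker than `H(k)` as long as piece 1 (linear-degree strong low-degree hardness) is open, and
equivalent to it the day piece 1 is proved. [BreslerHuang2022, Conj. 2.7 and §10 (context)] -/
theorem ldr_simulationAt_of_hardAt {k : ℕ}
    (hH : ∀ f : List Bool → List Bool, IsPolyTime f → ∀ ε : ℝ, 0 < ε →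
      ∀ᶠ n : ℕ in atTop, ∀ m : ℕ, m = ⌊5 * 2 ^ k * Real.log k / k * n⌋₊ →
      ((univ.filter fun Φ : Fin m → Fin k → Fin n × Bool => ∀ i, ∃ j,
      (f (encodingCNF.encode (List.ofFn fun a => List.ofFn fun b =>
      (((Φ a b).1 : ℕ), (Φ a b).2)))).getD (Φ i j).1 false = (Φ i j).2).card : ℝ) /
      Fintype.card (Fin m → Fin k → Fin n × Bool) ≤ ε) :
    ∃ C : ℝ, 0 < C ∧ ∀ δ : ℝ, 0 < δ → ∀ f : List Bool → List Bool,
      Literature.Computability.Complexity.IsPolyTime f → ∀ ε : ℝ, 0 < ε →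
      (∃ᶠ n : ℕ in Filter.atTop, ∀ m : ℕ, m = ⌊5 * 2 ^ k * Real.log k / k * n⌋₊ →
        ε * Fintype.card (Fin m → Fin k → Fin n × Bool) ≤
        ((Finset.univ.filter fun Φ : Fin m → Fin k → Fin n × Bool => ∀ i, ∃ j,
          (f (Literature.Computability.Complexity.encodingCNF.encode (List.ofFn fun a =>
            List.ofFn fun b => (((Φ a b).1 : ℕ), (Φ a b).2)))).getD (Φ i j).1 false =
            (Φ i j).2).card : ℝ)) →
      ∃ F : (n : ℕ) → (m : ℕ) → (Fin m → Fin k → Fin n × Bool) → Fin n → ℝ,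
      (∀ (n m : ℕ) (v : Fin n), Literature.Computability.Complexity.IsCoordDegreeLE ⌊δ * n⌋₊
        (fun y : Fin m × Fin k → Fin n × Bool => F n m (Function.curry y) v)) ∧
      (∀ n m : ℕ, m = ⌊5 * 2 ^ k * Real.log k / k * n⌋₊ →
        ∑ Φ : Fin m → Fin k → Fin n × Bool, ∑ v : Fin n, F n m Φ v ^ 2
          ≤ 1 * n * Fintype.card (Fin m → Fin k → Fin n × Bool)) ∧
      ∃ᶠ n : ℕ in Filter.atTop, ∀ m : ℕ, m = ⌊5 * 2 ^ k * Real.log k / k * n⌋₊ →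
        ε / 2 * Fintype.card (Fin m → Fin k → Fin n × Bool) ≤
        ((Finset.univ.filter fun Φ : Fin m → Fin k → Fin n × Bool =>
          (∀ v : Fin n, 1 ≤ |F n m Φ v|) ∧
          ∀ i : Fin m, ∃ j : Fin k, decide (0 ≤ F n m Φ (Φ i j).1) = (Φ i j).2).card : ℝ) := by
  refine ⟨1, one_pos, fun δ _ f hf ε hε hfreq => ?_⟩
  exact (_root_.Summit.PneNP.PneNP.Theorems.SearchHardWindow.Negative.kernelHypothesis_false_of_hardness
    (k := k) (α := 5 * 2 ^ k * Real.log k / k) hH hf hε hfreq).elim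


/-! ## The registered stubs and the composition to the crux BY NAME -/

/-- Stub 1 — piece `LinearDegreeHardness` (f-free; strong LDH at linear degree, `ε`-dependent rate).
[HuangSellke2025, Cor. 3.21; BreslerHuang2022, Thm. 2.6] -/
theorem stub_linearDegreeHardness :
    ∃ k₀ : ℕ, ∀ k ≥ k₀, ∀ C : ℝ, 0 < C → ∀ ε : ℝ, 0 < ε → ∃ δ : ℝ, 0 < δ ∧ ∀ F : (n : ℕ) → (m : ℕ) → (Fin m → Fin k → Fin n × Bool) → Fin n → ℝ, (∀ (n m : ℕ) (v : Fin n), Literature.Computability.Complexity.IsCoordDegreeLE ⌊δ * n⌋₊ (fun y : Fin m × Fin k → Fin n × Bool => F n m (Function.curry y) v)) → (∀ n m : ℕ, m = ⌊5 * 2 ^ k * Real.log k / k * n⌋₊ → ∑ Φ : Fin m → Fin k → Fin n × Bool, ∑ v : Fin n, F n m Φ v ^ 2 ≤ C * n * Fintype.card (Fin m → Fin k → Fin n × Bool)) → ∀ᶠ n : ℕ in Filter.atTop, ∀ m : ℕ, m = ⌊5 * 2 ^ k * Real.log k / k * n⌋₊ → ((Finset.univ.filter fun Φ : Fin m → Fin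 k → Fin n × Bool => (∀ v : Fin n, 1 ≤ |F n m Φ v|) ∧ ∀ i : Fin m, ∃ j : Fin k, decide (0 ≤ F n m Φ (Φ i j).1) = (Φ i j).2).card : ℝ) ≤ ε * Fintype.card (Fin m → Fin k → Fin n × Bool) := by
  sorry

/-- Stub 2 — piece `LinearDegreeSimulation` (the kernel; BH21 §10's expectation at linear degree).
[BreslerHuang2022, §10 and Conj. 2.7] -/
theorem stub_linearDegreeSimulation :
    ∃ k₁ : ℕ, ∀ k ≥ k₁, ∀ α : ℝ, 0 < α → ∃ C : ℝ, 0 < C ∧ ∀ δ : ℝ, 0 < δ → ∀ f : List Bool → List Bool, Literature.Computability.Complexity.IsPolyTime f → ∀ ε : ℝ, 0 < ε → (∃ᶠ n : ℕ in Filter.atTop, ∀ m : ℕ, m = ⌊α * n⌋₊ → ε * Fintype.card (Fin m → Fin k → Fin n × Bool) ≤ ((Finset.univ.filter fun Φ : Fin m → Fin k → Fin n × Bool => ∀ i, ∃ j, (f (Literature.Computability.Complexity.encodingCNF.encode (List.ofFn fun a => List.ofFn fun b => (((Φ a b).1 : ℕ), (Φ a b).2)))).getD (Φ i j).1 false = (Φ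 i j).2).card : ℝ)) → ∃ F : (n : ℕ) → (m : ℕ) → (Fin m → Fin k → Fin n × Bool) → Fin n → ℝ, (∀ (n m : ℕ) (v : Fin n), Literature.Computability.Complexity.IsCoordDegreeLE ⌊δ * n⌋₊ (fun y : Fin m × Fin k → Fin n × Bool => F n m (Function.curry y) v)) ∧ (∀ n m : ℕ, m = ⌊α * n⌋₊ → ∑ Φ : Fin m → Fin k → Fin n × Bool, ∑ v : Fin n, F n m Φ v ^ 2 ≤ C * n * Fintype.card (Fin m → Fin k → Fin n × Bool)) ∧ ∃ᶠ n : ℕ in Filter.atTop, ∀ m : ℕ, m = ⌊α * n⌋₊ → ε / 2 * Fintype.card (Fin m → Fin k → Fin n × Bool) ≤ ((Finset.univ.filter fun Φ : Fin m → Fin k → Fin n × Bool => (∀ v : Fin n, 1 ≤ |F n m Φ v|) ∧ ∀ i : Fin m, ∃ j : Fin k, decide (0 ≤ F n m Φ (Φ i j).1) = (Φ i j).2).card : ℝ) := by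
  sorry

/-- **Composition to the crux, by name.** -/
theorem SearchHardWindow_of :
    Summit.PneNP.PneNP.Theses.OverlapGapAlgebra.SearchHardWindow :=
  ldr_searchHardWindowBody_of_pieces stub_linearDegreeHardness stub_linearDegreeSimulation

end Summit.PneNP.PneNP.Cruxes.SearchHardWindow.LinearDegreeRedirect

end
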